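import Summits.QuantumFields.BalabanUV.Beta.EriceRemainderEnclosureHistoryAutonomyComparisonGapPersistence

/-!
# EriceRemainderEnclosureHistoryAutonomyComparisonDampedWindow — (E70e) THE STEP WITH DAMPED WINDOWS: along the comparison configuration `h′ ≤ h` from one
# pin of `B′ ≥ B` (isotone excess, `η = B′h′ − Bh′`) and the affine memory `B = b + Σ_{k<K} L_k·u_k`, the level gaps obey the DAMPED recursion
# **`D_{l+1}·(1 + φ_{l+1}·s_{l+1}) ≤ D_l + η`**, `φ_{l+1} = Σ_k L_k·h_{l+1+k}³·√((2l+3)∕(2l+3+2k))` (the BASE flow's pin sensitivity: (E64a)'s gap persistence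
# between the base solution from the perturbed pin `h′_{l+1}` and the base orbit), `s = r²∕(1+r)`, `r = h′_{l+1}∕h_{l+1}`; hence `D_k ≤ η·T_k` for every `T`
# with `T_0 = 0`, `T_l + 1 ≤ T_{l+1}(1 + φ_{l+1}s_{l+1})`, and THE STEP holds as soon as **`Σ_k L_k·(h_k³∕2)·T_k ≤ 1`** — (E58b)'s `Q ≤ 2` is `T_k = k`

Cell `pub-balaban`, β-function sub-cell, BINDER row D4 «RemainderConst leaves for Bałaban's split» (`HOME/BINDER-OWNERS.md`; owner lineage `b2b-balaban-beta-an4`;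
this file by co-owner #2 lineage `b2b-balaban-beta-d4-p2`, generation 60), β-FLOW TEAM duty (1), FREEZE (0) honoured (def-free; (E64a)'s `gap_eq_levelGap_mul` ∕
`sq_div_one_add_mono` ∕ `levelGap_sq_persist`, (E63a)'s `levelGap_succ_le` ∕ `levelGap_le_pin_gap`, (E49j)'s `excess_shift_le`, (E48a)'s `strictAnti_of_memFlow` ∕
`memFlow_tail`, node U2's `invSq_eq_of_memFlow` ∕ `seqBox_shift` ∕ `Sharpness.abs_sub_le_half_cube_mul`, (E41)'s `affine_monotone` ∕ `affine_floor` BY NAME; nothing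
restated).

HONEST FRAMING (page 1, verbatim and binding).  *"Discharging BetaPertH makes Bałaban's UV stability UNCONDITIONAL — a real constructive-QFT result; it is
NOT the continuum limit and NOT the Clay problem."*  THIS FILE DISCHARGES NOTHING OF THE KIND.  Elementary real analysis about ABSTRACT affine functionals on a
box ]0,γ]^ℕ with displayed floors, profiles and signs — hypotheses of a census, not facts; the form, signs, ages and moments of Bałaban's (1.22) limit functional
are NOT PRINTED ([I] p. 298; GAPS G-t4-U2-1∕-2) and NOT asserted.  Row D4 class UNCHANGED (critical-path width 0; instance 0∕1; D4 DISCHARGE NO DATE).  HONEST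
DEPENDENCY: continuum YM on T⁴ ⇐ BetaPertH ∧ nine spine estimates (0/9 proved); BetaPertH ⇐ (D1) ∧ (D4) ∧ CAP+tail; G-an2-4 gates asym, D1 and NE2/3/4.

THE POINT (census sense (α); the COMPARISON column, conjecture (E58′); route (R-a) of `HOME/b2b-balaban-beta-d4-p2/g60/e70/README.md`).  (E58b)'s STEP bounds
the level gap `D_l = 1∕h′_l² − 1∕h_l²` by `l·η` — every one of the `l` increments differs by at most the excess `η`, and the DROP part of each increment
difference is discarded.  That drop part is `B(h(l+1+·)) − B′(h′(l+1+·)) + [excess] = [B(h(l+1+·)) − B(U)] + [B(U) − B(h′(l+1+·))] + …` with `U` the BASE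
solution from the perturbed pin `h′_{l+1}` (squeezed `h′(l+1+·) ≤ U ≤ h(l+1+·)` when comparison from the deeper pin is handed down, as (E63a)'s principle does):
the middle term is `≥ 0` and the first is the base flow's PIN SENSITIVITY, bounded BELOW by (E64a)'s gap persistence: `≥ D_{l+1}·s(r)·φ_{l+1}` (§1).  So the
window that age `k` integrates is DAMPED: `D_k ≤ η·T_k` with `T_{l+1} = (T_l + 1)∕(1 + φ_{l+1}s_{l+1}) < l + 1`, and the STEP needs `Σ_k L_k(h_k³∕2)T_k ≤ 1`
(§2) instead of `Σ_k L_k(h_k³∕2)·k ≤ 1`.  At first order this is the Λ-criterion of the README (damping `f ≈ Σ_k L_k h_{l+1+k}³∕2` reduced by the persistence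
factor and by `s(r) ≤ ½`); the shape factor `s(r) = r²∕(1+r)`, `r = h′_{l+1}∕h_{l+1}`, is `½` at `r = 1` and is bounded below through `r² = 1∕(1 + h_{l+1}²D_{l+1})`.
NOT CLAIMED: a trajectory-free criterion (the END with `T` computed from the base flow and a size bound on `η` is the successor's); anything printed.

WHAT IS PROVED ([folklore]; 0 `def`, 0 sorry).  §1 **`damping_lb`** (the base flow's pin sensitivity from below).  §2 **`levelGap_le_damped_window`** (`D_l ≤ η·T_l`),
**`effective_le_of_family_le_at_damped_window`** (THE STEP under `Σ_k L_k(h_k³∕2)T_k ≤ 1`).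
-/
noncomputable section
open Finset Set

namespace Summit.QuantumFields.BalabanUV.Beta.EriceRemainderEnclosureHistoryAutonomyComparisonDampedWindow

open Literature.MathematicalPhysics.QuantumFieldTheory.Balaban1983to89
open Literature.MathematicalPhysics.QuantumFieldTheory.Balaban1983to89.T4BetaStationary
open Literature.MathematicalPhysics.QuantumFieldTheory.Balaban1983to89.T4BetaFlowWellPosed
open Literature.MathematicalPhysics.QuantumFieldTheory.Balaban1983to89.T4BetaFlowWellPosed.Sharpness (abs_sub_le_half_cube_mul)
open Summit.QuantumFields.BalabanUV.Beta.EriceRemainderEnclosureHistoryAutonomyOrder (strictAnti_of_memFlow memFlow_tail)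
open Summit.QuantumFields.BalabanUV.Beta.EriceRemainderEnclosureHistoryAutonomyComparisonExcess (excess_shift_le)
open Summit.QuantumFields.BalabanUV.Beta.EriceRemainderEnclosureHistoryAutonomyComparisonDropBound (levelGap_succ_le levelGap_le_pin_gap)
open Summit.QuantumFields.BalabanUV.Beta.EriceRemainderEnclosureHistoryAutonomyComparisonGapPersistence
  (gap_eq_levelGap_mul sq_div_one_add_mono levelGap_sq_persist)
open Summit.QuantumFields.BalabanUV.Beta.EriceRemainderEnclosureHistoryAutonomyMonotone (affine_monotone affine_floor)

variable {B' : (ℕ → ℝ) → ℝ} {γ b y z : ℝ} {L : ℕ → ℝ} {K : ℕ} {h h' U : ℕ → ℝ} {S : ℝ → ℕ → ℝ} {T : ℕ → ℝ}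

/-! ## §1 The base flow's pin sensitivity, from below -/

/-- **THE DAMPING FROM BELOW.**  `B = b + Σ_{k<K} L_k·u_k` (`b > 0`, `L ≥ 0`); `h` a box solution from `y > 0`; `U` a box solution (from any pin) lying below the
orbit segment `h(k′+·)`, `k′ ≥ 1`.  Then with `Δ₀ = 1∕U_0² − 1∕h_{k′}²` and `r₀ = U_0∕h_{k′}`:
**`Δ₀·(r₀²∕(1+r₀))·Σ_k L_k·h_{k′+k}³·√((2k′+1)∕(2(k′+k)+1)) ≤ B(h(k′+·)) − B(U)`** — each coupling gap `h_{k′+k} − U_k = Δ_k·h_{k′+k}³·r_k²∕(1+r_k)`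
((E64a) `gap_eq_levelGap_mul`) with `r_k ≥ r₀` (ratios of base solutions from ordered pins do not decrease) and `Δ_k ≥ Δ₀·√((2k′+1)∕(2(k′+k)+1))`
((E64a) `levelGap_sq_persist`). [folklore] -/
theorem damping_lb (hL : ∀ k, 0 ≤ L k) (hb : 0 < b) (hy : 0 < y) (hh : SeqBox γ h)
    (hf : MemFlow (fun u : ℕ → ℝ => b + ∑ k ∈ range K, L k * u k) y h) (hU : SeqBox γ U)
    (hfU : MemFlow (fun u : ℕ → ℝ => b + ∑ k ∈ range K, L k * u k) z U) {k' : ℕ} (hk' : 1 ≤ k') (hUle : ∀ i, U i ≤ h (k' + i)) :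
    (1 / U 0 ^ 2 - 1 / h k' ^ 2) * ((U 0 / h k') ^ 2 / (1 + U 0 / h k')) *
        ∑ k ∈ range K, L k * h (k' + k) ^ 3 * Real.sqrt ((2 * (k' : ℝ) + 1) / (2 * ((k' : ℝ) + k) + 1)) ≤
      (b + ∑ k ∈ range K, L k * h (k' + k)) - (b + ∑ k ∈ range K, L k * U k) := by
  set Bf : (ℕ → ℝ) → ℝ := fun u => b + ∑ k ∈ range K, L k * u k with hB_def
  have hmono : ∀ u v : ℕ → ℝ, SeqBox γ u → SeqBox γ v → (∀ j, u j ≤ v j) → Bf u ≤ Bf v := affine_monotone hL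
  have hlo : ∀ u, SeqBox γ u → b ≤ Bf u := affine_floor hL
  have hseg : SeqBox γ (fun j => h (k' + j)) := seqBox_shift hh k'
  have hfseg : MemFlow Bf (h k') (fun j => h (k' + j)) := memFlow_tail hf k'
  have hx0 := (hh k').1
  have hU0 := (hU 0).1
  set δ₀ : ℝ := 1 / U 0 ^ 2 - 1 / h k' ^ 2 with hδ₀
  set r₀ : ℝ := U 0 / h k' with hr₀_def
  have hr₀ : 0 ≤ r₀ := by positivity
  have hδ₀nn : 0 ≤ δ₀ := by
    have := hUle 0; simp only [add_zero] at this
    exact sub_nonneg.mpr (one_div_le_one_div_of_le (pow_pos hU0 2) (pow_le_pow_left₀ hU0.le this 2))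
  -- the right-hand side is the sum of the coupling gaps
  have hrhs : (b + ∑ k ∈ range K, L k * h (k' + k)) - (b + ∑ k ∈ range K, L k * U k) = ∑ k ∈ range K, L k * (h (k' + k) - U k) := by
    rw [show (b + ∑ k ∈ range K, L k * h (k' + k)) - (b + ∑ k ∈ range K, L k * U k) =
      ∑ k ∈ range K, L k * h (k' + k) - ∑ k ∈ range K, L k * U k by ring, ← sum_sub_distrib]
    exact sum_congr rfl fun k _ => by ring
  rw [hrhs, mul_sum]
  refine sum_le_sum fun k _ => ?_
  -- names at scale k
  have hx := (hh (k' + k)).1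
  have hUk := (hU k).1
  set x := h (k' + k) with hx_def
  set Δ : ℝ := 1 / U k ^ 2 - 1 / x ^ 2 with hΔ
  have hΔnn : 0 ≤ Δ := sub_nonneg.mpr (one_div_le_one_div_of_le (pow_pos hUk 2) (pow_le_pow_left₀ hUk.le (hUle k) 2))
  have hΔle : Δ ≤ δ₀ := by
    have := levelGap_le_pin_gap (B' := Bf) (k := fun j => h (k' + j)) (k' := U) hmono hseg hfseg hU hfU hUle k
    simp only [hΔ, hδ₀]; simpa [hfU.1] using this
  -- ratio persistence r_k ≥ r₀
  have hrr : r₀ ≤ U k / x := by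
    have hUanti := (strictAnti_of_memFlow hb hlo hU hfU).antitone (Nat.zero_le k)
    have e1 : (U k / x) ^ 2 = 1 - Δ * U k ^ 2 := by simp only [hΔ]; field_simp; ring
    have e2 : r₀ ^ 2 = 1 - δ₀ * U 0 ^ 2 := by simp only [hδ₀, hr₀_def]; field_simp; ring
    have hsq : r₀ ^ 2 ≤ (U k / x) ^ 2 := by
      rw [e1, e2]
      have : Δ * U k ^ 2 ≤ δ₀ * U 0 ^ 2 := mul_le_mul hΔle (pow_le_pow_left₀ hUk.le hUanti 2) (sq_nonneg _) hδ₀nn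
      linarith
    exact (pow_le_pow_iff_left₀ hr₀ (by positivity) two_ne_zero).mp hsq
  have hshape := sq_div_one_add_mono hr₀ hrr
  -- persistence Δ ≥ δ₀ √((2k'+1)/(2(k'+k)+1))
  have hpers := levelGap_sq_persist hL hb hy hh hf hU hfU hk' hUle k
  rw [show k' + 0 = k' by rfl] at hpers
  set t : ℝ := (2 * (k' : ℝ) + 1) / (2 * ((k' : ℝ) + k) + 1) with ht
  have ht0 : 0 ≤ t := by positivity
  have hΔt : δ₀ * Real.sqrt t ≤ Δ := by
    have hsq : (δ₀ * Real.sqrt t) ^ 2 ≤ Δ ^ 2 := by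
      rw [mul_pow, Real.sq_sqrt ht0]
      have e : δ₀ ^ 2 * t = δ₀ ^ 2 * (2 * (k' : ℝ) + 1) / (2 * ((k' : ℝ) + k) + 1) := by rw [ht]; ring
      rw [e, div_le_iff₀ (by positivity)]
      simpa [hδ₀, hΔ] using hpers
    exact (pow_le_pow_iff_left₀ (by positivity) hΔnn two_ne_zero).mp hsq
  -- assemble
  have hgap := gap_eq_levelGap_mul hx hUk
  have hs0 : 0 ≤ r₀ ^ 2 / (1 + r₀) := by positivity
  have hx3 : 0 ≤ L k * x ^ 3 := mul_nonneg (hL k) (pow_nonneg hx.le 3)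
  calc δ₀ * (r₀ ^ 2 / (1 + r₀)) * (L k * x ^ 3 * Real.sqrt t)
      = (δ₀ * Real.sqrt t) * (L k * x ^ 3) * (r₀ ^ 2 / (1 + r₀)) := by ring
    _ ≤ Δ * (L k * x ^ 3) * (r₀ ^ 2 / (1 + r₀)) :=
        mul_le_mul_of_nonneg_right (mul_le_mul_of_nonneg_right hΔt hx3) hs0
    _ ≤ Δ * (L k * x ^ 3) * ((U k / x) ^ 2 / (1 + U k / x)) := mul_le_mul_of_nonneg_left hshape (mul_nonneg hΔnn hx3)
    _ = L k * (Δ * x ^ 3 * ((U k / x) ^ 2 / (1 + U k / x))) := by ring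
    _ = L k * (x - U k) := by rw [← hgap]

/-! ## §2 The damped level-gap recursion and THE STEP with damped windows -/

/-- **THE LEVEL GAP OBEYS THE DAMPED RECURSION.**  `B = b + Σ_{k<K} L_k·u_k` (`b > 0`, `L ≥ 0`), `B′ ≥ B` with ISOTONE excess; `h`, `h′` box solutions of
`B`, `B′` from one pin `y` with `h′ ≤ h`; base solutions from ordered pins are ordered (`hpin`, (E48a) `le_of_pin_le`); `S q` a box solution of `B` from every
pin `q` with the perturbed tails below it, `h′(l+1+·) ≤ S(h′_{l+1})` (`htail` — comparison from the deeper pins, handed down by (E63a)'s principle).  Then for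
every `T` with `T_0 = 0` and `T_l + 1 ≤ T_{l+1}·(1 + φ_{l+1}·s_{l+1})`, where `φ_{l+1} = Σ_k L_k·h_{l+1+k}³·√((2l+3)∕(2(l+1+k)+1))` and
`s_{l+1} = r²∕(1+r)`, `r = h′_{l+1}∕h_{l+1}`: **`1∕h′_l² − 1∕h_l² ≤ (B′h′ − Bh′)·T_l`** at every scale `l`. [folklore] -/
theorem levelGap_le_damped_window (hL : ∀ k, 0 ≤ L k) (hb : 0 < b)
    (hexc : ∀ u, SeqBox γ u → (fun u : ℕ → ℝ => b + ∑ k ∈ range K, L k * u k) u ≤ B' u)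
    (hDmono : ∀ u v : ℕ → ℝ, SeqBox γ u → SeqBox γ v → (∀ j, u j ≤ v j) →
      B' u - (fun u : ℕ → ℝ => b + ∑ k ∈ range K, L k * u k) u ≤ B' v - (fun u : ℕ → ℝ => b + ∑ k ∈ range K, L k * u k) v)
    (hpin : ∀ t t' : ℝ, ∀ u u' : ℕ → ℝ, 0 < t → t ≤ t' → t' ≤ γ → SeqBox γ u → SeqBox γ u' →
      MemFlow (fun u : ℕ → ℝ => b + ∑ k ∈ range K, L k * u k) t u → MemFlow (fun u : ℕ → ℝ => b + ∑ k ∈ range K, L k * u k) t' u' → ∀ j, u j ≤ u' j)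
    (hS : ∀ q, 0 < q → q ≤ γ → SeqBox γ (S q) ∧ MemFlow (fun u : ℕ → ℝ => b + ∑ k ∈ range K, L k * u k) q (S q))
    (hy : 0 < y) (hh : SeqBox γ h) (hf : MemFlow (fun u : ℕ → ℝ => b + ∑ k ∈ range K, L k * u k) y h)
    (hh' : SeqBox γ h') (hf' : MemFlow B' y h') (hle : ∀ j, h' j ≤ h j) (htail : ∀ l j, h' (l + 1 + j) ≤ S (h' (l + 1)) j)
    (hT0 : T 0 = 0)
    (hT : ∀ l : ℕ, T l + 1 ≤ T (l + 1) * (1 + (∑ k ∈ range K, L k * h (l + 1 + k) ^ 3 *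
        Real.sqrt ((2 * ((l : ℝ) + 1) + 1) / (2 * (((l : ℝ) + 1) + k) + 1))) * ((h' (l + 1) / h (l + 1)) ^ 2 / (1 + h' (l + 1) / h (l + 1)))))
    (l : ℕ) : 1 / h' l ^ 2 - 1 / h l ^ 2 ≤ (B' h' - (b + ∑ k ∈ range K, L k * h' k)) * T l := by
  set Bf : (ℕ → ℝ) → ℝ := fun u => b + ∑ k ∈ range K, L k * u k with hB_def
  have hmono : ∀ u v : ℕ → ℝ, SeqBox γ u → SeqBox γ v → (∀ j, u j ≤ v j) → Bf u ≤ Bf v := affine_monotone hL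
  have hlo : ∀ u, SeqBox γ u → b ≤ Bf u := affine_floor hL
  have hlo' : ∀ u, SeqBox γ u → b ≤ B' u := fun u hu => (hlo u hu).trans (hexc u hu)
  have hanti' : Antitone h' := (strictAnti_of_memFlow hb hlo' hh' hf').antitone
  set η : ℝ := B' h' - Bf h' with hη_def
  have hηs : ∀ n, |Bf (fun j => h' (n + 1 + j)) - B' (fun j => h' (n + 1 + j))| ≤ η := excess_shift_le hexc hDmono hh' hanti'
  have hη0 : 0 ≤ η := by rw [hη_def]; linarith [hexc h' hh']
  induction l with
  | zero =>
    have e : h' 0 = h 0 := by rw [hf.1, hf'.1]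
    rw [e, sub_self, hT0, mul_zero]
  | succ l ih =>
    -- abbreviations at scale l+1
    have hz := (hh' (l + 1)).1
    have hzγ := (hh' (l + 1)).2
    have hx := (hh (l + 1)).1
    obtain ⟨hUbox, hfU⟩ := hS (h' (l + 1)) hz hzγ
    set U := S (h' (l + 1)) with hU_def
    have hU0 : U 0 = h' (l + 1) := hfU.1
    -- squeeze: h'(l+1+·) ≤ U ≤ h(l+1+·)
    have hlow : ∀ j, h' (l + 1 + j) ≤ U j := htail l
    have hup : ∀ j, U j ≤ h (l + 1 + j) := fun j =>
      hpin (h' (l + 1)) (h (l + 1)) U (fun j => h (l + 1 + j)) hz (hle (l + 1)) (hh (l + 1)).2 hUbox (seqBox_shift hh (l + 1))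
        hfU (memFlow_tail hf (l + 1)) j
    -- the damping and shape factors
    set φ : ℝ := ∑ k ∈ range K, L k * h (l + 1 + k) ^ 3 * Real.sqrt ((2 * ((l : ℝ) + 1) + 1) / (2 * (((l : ℝ) + 1) + k) + 1)) with hφ_def
    set s : ℝ := (h' (l + 1) / h (l + 1)) ^ 2 / (1 + h' (l + 1) / h (l + 1)) with hs_def
    have hφ0 : 0 ≤ φ := sum_nonneg fun k _ => mul_nonneg (mul_nonneg (hL k) (pow_nonneg (hh (l + 1 + k)).1.le 3)) (Real.sqrt_nonneg _)
    have hs0 : 0 ≤ s := by have := (hh' (l + 1)).1; positivity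
    -- increment difference
    have hincr : (1 / h' (l + 1) ^ 2 - 1 / h (l + 1) ^ 2) - (1 / h' l ^ 2 - 1 / h l ^ 2) =
        B' (fun j => h' (l + 1 + j)) - Bf (fun j => h (l + 1 + j)) := by
      rw [hf'.2 l, hf.2 l]; ring
    -- (1) excess at the shifted configuration ≤ η
    have h1 : B' (fun j => h' (l + 1 + j)) - Bf (fun j => h' (l + 1 + j)) ≤ η := by
      have := (abs_le.mp (hηs l)).1; linarith
    -- (2) Bf(h'(l+1+·)) ≤ Bf U
    have h2 : Bf (fun j => h' (l + 1 + j)) ≤ Bf U := hmono _ _ (seqBox_shift hh' (l + 1)) hUbox hlow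
    -- (3) damping: D_{l+1}·s·φ ≤ Bf(h(l+1+·)) − Bf U
    have h3 : (1 / h' (l + 1) ^ 2 - 1 / h (l + 1) ^ 2) * s * φ ≤ Bf (fun j => h (l + 1 + j)) - Bf U := by
      have hd := damping_lb (z := h' (l + 1)) hL hb hy hh hf hUbox hfU (k' := l + 1) (by omega) hup
      rw [hU0] at hd
      have e1 : ((l + 1 : ℕ) : ℝ) = (l : ℝ) + 1 := by push_cast; ring
      simp only [e1] at hd
      simpa [hB_def, hs_def, hφ_def] using hd
    -- combine: D_{l+1} (1 + φ s) ≤ D_l + η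
    have hD : (1 / h' (l + 1) ^ 2 - 1 / h (l + 1) ^ 2) * (1 + φ * s) ≤ (1 / h' l ^ 2 - 1 / h l ^ 2) + η := by
      nlinarith [hincr, h1, h2, h3]
    -- and D_l + η ≤ η (T_l + 1) ≤ η T_{l+1} (1 + φ s)
    have hTl := hT l
    simp only [← hφ_def, ← hs_def] at hTl
    have hpos : 0 < 1 + φ * s := by nlinarith [mul_nonneg hφ0 hs0]
    have hchain : (1 / h' (l + 1) ^ 2 - 1 / h (l + 1) ^ 2) * (1 + φ * s) ≤ η * T (l + 1) * (1 + φ * s) := by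
      have e2 : η * (T l + 1) ≤ η * (T (l + 1) * (1 + φ * s)) := mul_le_mul_of_nonneg_left hTl hη0
      nlinarith [hD, ih, e2]
    exact le_of_mul_le_mul_right hchain hpos

/-- **THE STEP WITH DAMPED WINDOWS.**  Under the hypotheses of `levelGap_le_damped_window`, if **`Σ_{k<K} L_k·(h_k³∕2)·T_k ≤ 1`** then `B h ≤ B′ h′` —
the effective β-functions are ordered at this pin.  With `T_k = k` (always admissible) this is (E58b)'s STEP from `Q ≤ 2`; the damped `T` is smaller.
[folklore] -/
theorem effective_le_of_family_le_at_damped_window (hL : ∀ k, 0 ≤ L k) (hb : 0 < b)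
    (hexc : ∀ u, SeqBox γ u → (fun u : ℕ → ℝ => b + ∑ k ∈ range K, L k * u k) u ≤ B' u)
    (hDmono : ∀ u v : ℕ → ℝ, SeqBox γ u → SeqBox γ v → (∀ j, u j ≤ v j) →
      B' u - (fun u : ℕ → ℝ => b + ∑ k ∈ range K, L k * u k) u ≤ B' v - (fun u : ℕ → ℝ => b + ∑ k ∈ range K, L k * u k) v)
    (hpin : ∀ t t' : ℝ, ∀ u u' : ℕ → ℝ, 0 < t → t ≤ t' → t' ≤ γ → SeqBox γ u → SeqBox γ u' →
      MemFlow (fun u : ℕ → ℝ => b + ∑ k ∈ range K, L k * u k) t u → MemFlow (fun u : ℕ → ℝ => b + ∑ k ∈ range K, L k * u k) t' u' → ∀ j, u j ≤ u' j)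
    (hS : ∀ q, 0 < q → q ≤ γ → SeqBox γ (S q) ∧ MemFlow (fun u : ℕ → ℝ => b + ∑ k ∈ range K, L k * u k) q (S q))
    (hy : 0 < y) (hh : SeqBox γ h) (hf : MemFlow (fun u : ℕ → ℝ => b + ∑ k ∈ range K, L k * u k) y h)
    (hh' : SeqBox γ h') (hf' : MemFlow B' y h') (hle : ∀ j, h' j ≤ h j) (htail : ∀ l j, h' (l + 1 + j) ≤ S (h' (l + 1)) j)
    (hT0 : T 0 = 0)
    (hT : ∀ l : ℕ, T l + 1 ≤ T (l + 1) * (1 + (∑ k ∈ range K, L k * h (l + 1 + k) ^ 3 *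
        Real.sqrt ((2 * ((l : ℝ) + 1) + 1) / (2 * (((l : ℝ) + 1) + k) + 1))) * ((h' (l + 1) / h (l + 1)) ^ 2 / (1 + h' (l + 1) / h (l + 1)))))
    (hΛ : ∑ k ∈ range K, L k * (h k ^ 3 / 2) * T k ≤ 1) :
    (b + ∑ k ∈ range K, L k * h k) ≤ B' h' := by
  have hlev := levelGap_le_damped_window hL hb hexc hDmono hpin hS hy hh hf hh' hf' hle htail hT0 hT
  set η : ℝ := B' h' - (b + ∑ k ∈ range K, L k * h' k) with hη_def
  have hη0 : 0 ≤ η := by have := hexc h' hh'; simp only at this; rw [hη_def]; linarith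
  -- T ≥ 0
  have hTnn : ∀ k, 0 ≤ T k := by
    intro k
    induction k with
    | zero => rw [hT0]
    | succ k ihk =>
      have hTk := hT k
      have hφ0 : 0 ≤ ∑ k' ∈ range K, L k' * h (k + 1 + k') ^ 3 * Real.sqrt ((2 * ((k : ℝ) + 1) + 1) / (2 * (((k : ℝ) + 1) + k') + 1)) :=
        sum_nonneg fun k' _ => mul_nonneg (mul_nonneg (hL k') (pow_nonneg (hh (k + 1 + k')).1.le 3)) (Real.sqrt_nonneg _)
      have hs0 : 0 ≤ (h' (k + 1) / h (k + 1)) ^ 2 / (1 + h' (k + 1) / h (k + 1)) := by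
        have := (hh' (k + 1)).1; have := (hh (k + 1)).1; positivity
      have hpos : 0 < 1 + (∑ k' ∈ range K, L k' * h (k + 1 + k') ^ 3 * Real.sqrt ((2 * ((k : ℝ) + 1) + 1) / (2 * (((k : ℝ) + 1) + k') + 1))) *
          ((h' (k + 1) / h (k + 1)) ^ 2 / (1 + h' (k + 1) / h (k + 1))) := by nlinarith [mul_nonneg hφ0 hs0]
      by_contra hneg
      rw [not_le] at hneg
      have : T (k + 1) * (1 + (∑ k' ∈ range K, L k' * h (k + 1 + k') ^ 3 * Real.sqrt ((2 * ((k : ℝ) + 1) + 1) / (2 * (((k : ℝ) + 1) + k') + 1))) *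
          ((h' (k + 1) / h (k + 1)) ^ 2 / (1 + h' (k + 1) / h (k + 1)))) < 0 := mul_neg_of_neg_of_pos hneg hpos
      linarith
  -- the gap at scale k: h_k − h′_k ≤ (h_k³/2)·η·T_k
  have hgap : ∀ k : ℕ, h k - h' k ≤ h k ^ 3 / 2 * (η * T k) := by
    intro k
    have hlev0 : 0 ≤ 1 / h' k ^ 2 - 1 / h k ^ 2 :=
      sub_nonneg.mpr (one_div_le_one_div_of_le (pow_pos (hh' k).1 2) (pow_le_pow_left₀ (hh' k).1.le (hle k) 2))
    have hw := abs_sub_le_half_cube_mul (hh k).1 (hh' k).1 le_rfl (hle k)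
    have habs : |1 / h k ^ 2 - 1 / h' k ^ 2| ≤ η * T k := by
      rw [abs_sub_comm, abs_of_nonneg hlev0]; exact hlev k
    exact (le_abs_self _).trans (hw.trans (mul_le_mul_of_nonneg_left habs (by have := (hh k).1; positivity)))
  -- the drop
  have hdrop : (b + ∑ k ∈ range K, L k * h k) - (b + ∑ k ∈ range K, L k * h' k) ≤ η := by
    calc (b + ∑ k ∈ range K, L k * h k) - (b + ∑ k ∈ range K, L k * h' k) = ∑ k ∈ range K, L k * (h k - h' k) := by
          rw [show (b + ∑ k ∈ range K, L k * h k) - (b + ∑ k ∈ range K, L k * h' k) =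
            ∑ k ∈ range K, L k * h k - ∑ k ∈ range K, L k * h' k by ring, ← sum_sub_distrib]
          exact sum_congr rfl fun k _ => by ring
      _ ≤ ∑ k ∈ range K, L k * (h k ^ 3 / 2 * (η * T k)) := sum_le_sum fun k _ => mul_le_mul_of_nonneg_left (hgap k) (hL k)
      _ = (∑ k ∈ range K, L k * (h k ^ 3 / 2) * T k) * η := by rw [sum_mul]; exact sum_congr rfl fun k _ => by ring
      _ ≤ 1 * η := mul_le_mul_of_nonneg_right hΛ hη0
      _ = η := one_mul η
  rw [hη_def] at hdrop
  linarith

end Summit.QuantumFields.BalabanUV.Beta.EriceRemainderEnclosureHistoryAutonomyComparisonDampedWindow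

end
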